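import Summits.BirchSwinnertonDyer.BirchSwinnertonDyer.Theorems.PrintCf2RubinValueTwoRowTwoTwistedKummerClass
import Literature.NumberTheory.ComplexMultiplication.EllipticUnits.RubinEulerSystem
import Literature.NumberTheory.GaloisRepresentations.LocalWeilDatum
import Mathlib.FieldTheory.Galois.Infinite
import HarnessLib

/-!
# M-LINE-PIN / (α3) ROW 2, FILE 3i: INJECTIVITY of the twisted Kummer map on global units —
# `κ_k(u) = 0 in H¹(G_S(F), μ_{p^k} ⊗ θ) ⟹ u ∈ ℰ(F)^{p^k}`

Cell `bsd-print-cf2`, WIDTH seat `bsd-line-cf2-p1-w6` g9 (prover-bsd-line-cf2-p1-w6-g9-0), successor of g8 on (α3) ROW 2 of the JLK road on the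
DECIDING child stmt-BirchSwinnertonDyer-24721 `PrintCf2RubinValueTwo.MainConjClauseAtSplitTwoQuadDA` (memo `HOME/bsd-line-cf2-p1-w6/ROW2-RHO3-SPEC-w6g9.md`
§1 (K-c): an input of the KERNEL half of ρ3); `--supports` that item (helper, Theses-free). HONEST FRAMING: Kummer theory (Hilbert 90 is not even
needed: a class vanishing on the nose is the coboundary of a root of unity); nothing here closes the crux or a registered stub; no summit statement is
proved by this seat; BSD is not proved by any of this. THEOREMS ONLY (no definition, no named fact, no instance, no `sorry`).

WHAT.
* §1 `exists_smul_eq_of_isTwistedKummerClass_zero` — if `0` is a twisted Kummer class of `β` at a level `U` on which `θ` is trivial, then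
  `β = w·ζ` with `ζ ∈ μ_{p^k}` and `w` FIXED by `U` (the cocycle `σ ↦ σβ/β` is the coboundary `σ ↦ σζ/ζ` of some `ζ ∈ (μ_{p^k} ⊗ θ)^{N_S}`,
  `ContinuousH1.oneCocycleClass_eq_zero_iff`);
* §2 `mem_of_forall_mem_galFixing_smul_eq` — Galois correspondence in `K̄/K`: an element fixed by `Gal(K̄/F)` lies in `F`
  (`InfiniteGalois.fixedField_fixingSubgroup`);
* §3 **`exists_globalUnitsOf_pow_eq_of_isTwistedKummerClass_zero`** — for `U = Gal(K̄/F)`: if `u ∈ ℰ(F)`, `β^{p^k} = u` and `0` is a twisted Kummer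
  class of `β`, then `u = w^{p^k}` for a global unit `w ∈ ℰ(F)`. I.e. the levelwise Kummer map `ℰ(F)/ℰ(F)^{p^k} → H¹(G_S(F), μ_{p^k} ⊗ θ)` of ROW 2
  (g8 FILE 3a, g9 FILE 3g) is INJECTIVE — Cor. 3.4 of JLK ("`𝒪_F[1/p]^× ⊗ ℤ_p ⊂ H¹(𝒪_F[1/p], ℤ_p(1))`") at finite level.

presearch: «Kummer map injective, kernel of x ↦ (σ ↦ σ(x^{1/n})/x^{1/n})» → Serre, *Local Fields* X §3 b) / JLK Cor. 3.4 [corpus: arXiv 0804.2828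
p0010 L40–46]; tree `GaloisCohomologyKummerProofs.mem_range_powMonoidHom_of_kummerMap_eq_one` is the base-field (`Γ_K`) version — the level-`U`,
`G_S`, twisted version here is new plumbing, not a new theorem. beyond-print theorem: no.

References: J. Johnson-Leung, G. Kings, J. reine angew. Math. 653 (2011) §3.3, Cor. 3.4; J.-P. Serre, *Local Fields* (1979) X §3 b).
-/

noncomputable section

open scoped Classical

-- the summit namespace `Summit.BirchSwinnertonDyer.BirchSwinnertonDyer` repeats the problem name by design (D-0017)
set_option linter.dupNamespace false
set_option autoImplicit false

open scoped NumberField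
open Field IsDedekindDomain IntermediateField
open Literature.NumberTheory.GaloisRepresentations Literature.NumberTheory.GaloisRepresentations.DiscreteGaloisModule
open Literature.NumberTheory.GaloisRepresentations.LocalWeilDatum
open Literature.NumberTheory.ComplexMultiplication.EllipticUnits
open Literature.NumberTheory.ComplexMultiplication.EllipticUnits.JohnsonLeungKings2011

namespace Summit.BirchSwinnertonDyer.BirchSwinnertonDyer.Theorems.PrintCf2.RowTwo

variable {K : Type} [Field K] [NumberField K] (p : ℕ) [Fact p.Prime] (S : Set (HeightOneSpectrum (𝓞 K)))
  (θ : absoluteGaloisGroup K →ₜ* ℤ_[p]ˣ) (k : ℕ) (U : Subgroup (absoluteGaloisGroup K))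

/-! ## §1. A vanishing twisted Kummer class is the coboundary of a root of unity -/

omit [NumberField K] in
/-- **If `0` is a twisted Kummer class of `β` at a level `U` with `θ|_U = 1`, then `β = w·ζ` with `ζ^{p^k} = 1` and `w` fixed by `U`**: a
cocycle of class `0` is a coboundary `g ↦ g·v − v` of some `v = ζ ∈ (μ_{p^k} ⊗ θ)^{N_S}` (`oneCocycleClass_eq_zero_iff`), and on `U` the twisted action on
`ζ` is the Galois action, so `σβ/β = σζ/ζ`. [cite: SerreLocalFields1979, X §3 b)] [cite: JohnsonLeungKings2011, §3.3 (5)–(6) and Cor. 3.4 (arXiv p0010:L40–70)] -/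
theorem exists_smul_eq_of_isTwistedKummerClass_zero (hθU : ∀ σ ∈ U, θ σ = 1) {β : (AlgebraicClosure K)ˣ}
    (hc : IsTwistedKummerClass p θ S U k β 0) :
    ∃ ζ : (AlgebraicClosure K)ˣ, ζ ^ (p ^ k) = 1 ∧ ∀ σ ∈ U, σ • (β * ζ⁻¹) = β * ζ⁻¹ := by
  obtain ⟨φ₀, h0, hφ⟩ := hc
  let X := (coeffGS p S θ k).toTopRep
  let φ : contOneCocycles (subgroupRep X (imGS S U)) := φ₀
  have h0' : oneCocycleClass (subgroupRep X (imGS S U)) φ = 0 := h0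
  obtain ⟨v, hv⟩ := (oneCocycleClass_eq_zero_iff _ φ).mp h0'
  refine ⟨muVal K (p ^ k) ((v : Representation.invariants
      ((muTwist p θ k).toRepresentation.comp (ramificationSubgroup K S).subtype)) : MuCarrier K (p ^ k)), muVal_pow_eq_one K (p ^ k) _,
    fun σ hσ ↦ ?_⟩
  -- `σβ/β = σζ/ζ`
  have h1 := hφ σ hσ
  rw [hv ⟨toUnramifiedQuot K S σ, Subgroup.mem_map_of_mem _ hσ⟩] at h1
  change muVal K (p ^ k) ((((subgroupRep X (imGS S U)).ρ _ v - v : X) : Representation.invariants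
      ((muTwist p θ k).toRepresentation.comp (ramificationSubgroup K S).subtype)) : MuCarrier K (p ^ k)) = σ • β / β at h1
  rw [Submodule.coe_sub, muVal_sub, subgroupRep_ρ_apply] at h1
  change muVal K (p ^ k) (muTwist p θ k σ _) / _ = _ at h1
  rw [muTwist_apply_of_apply_eq_one p θ k (hθU σ hσ), muVal_apply] at h1
  simp only [Submodule.subtype_apply] at h1
  -- rearrange: `σ(β ζ⁻¹) = β ζ⁻¹`
  set ζ := muVal K (p ^ k) ((v : Representation.invariants
      ((muTwist p θ k).toRepresentation.comp (ramificationSubgroup K S).subtype)) : MuCarrier K (p ^ k))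
  rw [div_eq_div_iff_mul_eq_mul] at h1
  rw [smul_mul', smul_inv', mul_inv_eq_iff_eq_mul, eq_mul_inv_of_mul_eq h1.symm, mul_comm (β * ζ⁻¹) (σ • ζ), mul_assoc]

/-! ## §2. Galois correspondence: fixed by `Gal(K̄/F)` means in `F` -/

omit [NumberField K] in
/-- **An element of `K̄` fixed by `Gal(K̄/F)` lies in `F`** (`K̄/K` Galois; Krull's Galois correspondence `InfiniteGalois.fixedField_fixingSubgroup`,
transported along the identity `absoluteGaloisGroup.toAlgEquiv`). [folklore] -/
theorem mem_of_forall_mem_galFixing_smul_eq [IsGalois K (AlgebraicClosure K)] (F : IntermediateField K (AlgebraicClosure K))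
    {x : AlgebraicClosure K} (hx : ∀ σ ∈ galFixing K F, σ • x = x) : x ∈ F := by
  rw [← InfiniteGalois.fixedField_fixingSubgroup F]
  refine (IntermediateField.mem_fixedField_iff _ _).mpr fun f hf ↦ ?_
  have hmem : (absoluteGaloisGroup.toAlgEquiv K).symm f ∈ galFixing K F := by
    change (absoluteGaloisGroup.toAlgEquiv K) ((absoluteGaloisGroup.toAlgEquiv K).symm f) ∈ F.fixingSubgroup
    rwa [MulEquiv.apply_symm_apply]
  have h := hx _ hmem
  rwa [absoluteGaloisGroup.smul_def, MulEquiv.apply_symm_apply] at h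

/-! ## §3. Injectivity of the Kummer map on global units -/

omit [NumberField K] in
/-- **`κ_k(u) = 0 ⟹ u ∈ ℰ(F)^{p^k}`** (`U = Gal(K̄/F)`, `θ|_U = 1`): if `u ∈ ℰ(F)`, `β^{p^k} = u` and `0` is a twisted Kummer class of `β`, then `u = w^{p^k}`
for some `w ∈ ℰ(F)` — `w = βζ⁻¹` of §1 lies in `F` (§2) and is a unit (its `p^k`-th power and that of its inverse are integral). The injectivity of
`𝒪_F^×/p^k → H¹(𝒪_F[1/S], μ_{p^k})` (Cor. 3.4 "`𝒪_F[1/p]^× ⊗ ℤ_p ⊂ H¹(𝒪_F[1/p], ℤ_p(1))`" at finite level).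
[cite: JohnsonLeungKings2011, Cor. 3.4 (arXiv p0010:L40–46)] [cite: SerreLocalFields1979, X §3 b)] -/
theorem exists_globalUnitsOf_pow_eq_of_isTwistedKummerClass_zero [IsGalois K (AlgebraicClosure K)] (F : IntermediateField K (AlgebraicClosure K))
    (hθF : ∀ σ ∈ galFixing K F, θ σ = 1) {u β : (AlgebraicClosure K)ˣ} (hu : u ∈ globalUnitsOf F) (hβ : β ^ (p ^ k) = u)
    (hc : IsTwistedKummerClass p θ S (galFixing K F) k β 0) :
    ∃ w ∈ globalUnitsOf F, w ^ (p ^ k) = u := by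
  obtain ⟨ζ, hζ, hfix⟩ := exists_smul_eq_of_isTwistedKummerClass_zero p S θ k (galFixing K F) hθF hc
  have hpow : (β * ζ⁻¹) ^ (p ^ k) = u := by rw [mul_pow, inv_pow, hζ, inv_one, mul_one, hβ]
  have hp : 0 < p ^ k := pow_pos (Fact.out : p.Prime).pos k
  refine ⟨β * ζ⁻¹, ⟨?_, ?_, ?_⟩, hpow⟩
  · refine IsIntegral.of_pow hp ?_
    rw [← Units.val_pow_eq_pow_val, hpow]
    exact hu.1
  · refine IsIntegral.of_pow hp ?_
    rw [← Units.val_pow_eq_pow_val, inv_pow, hpow]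
    exact hu.2.1
  · exact mem_of_forall_mem_galFixing_smul_eq F fun σ hσ ↦ by rw [← Units.coe_smul, hfix σ hσ]

end Summit.BirchSwinnertonDyer.BirchSwinnertonDyer.Theorems.PrintCf2.RowTwo

end
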